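import Summits.Parity.GeneralizedHardyLittlewood.Theorems.Dhl42ChainCondC
import Literature.NumberTheory.Sieve.PolymathBoundedGaps

/-!
# DHL[42,2] certificate — Definitions 4.1/4.2, Proposition 5.1, Proposition 5.3 for general data

§1 `GradeData`, `PC` (Definition 4.1), thickenings `thicken Ω ϱ = Ω^{+ϱ}`, `Admissible` (Definition
4.2) and its monotonicity; §2 Proposition 5.1; §3 perturbation facts for `U`; §4 Proposition 5.3 for
one grade (`pc_clause_of_staircase`, the heart of the argument); §5 Definition 5.2 (`StaircaseData`,
regions `Staircase.OmegaF/OmegaG` of general data) and Proposition 5.3 in general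
(`Staircase.admissible`). NOT here: the §7 instance (→ `Dhl42StaircaseInstance`).

Origin: `Dhl42/Staircase.lean` of the DHL[42,2] certificate package (pub-dhl42 bundle, archive blob
`18cce9e3`; sha256[:16] of the file `6560125ec2016ae9`; paper snapshot = `paper/main.tex` v1), lines
:39–:392; statements and proofs unchanged except: namespace `TpY4Dhl42` →
`Summit.Parity.GeneralizedHardyLittlewood.Theorems.Dhl42`, the package's `simplexSet n B` replaced
by the tree's definitionally equal `Literature.NumberTheory.Sieve.scaledSimplex n B` (also inside
declaration names), docstrings added where missing (the docstring of `PC` re-worded for the tree: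
package-internal pointers removed, mathematics unchanged), `#print axioms` lines dropped.
Package-internal references in the verbatim docstrings (`Dhl42/….lean`, `Assumed.…`, `row 9…`,
`gen n`, `inputs/COMPARE.md`) refer to that package (paper Appendix B).

Declarations (30): `GradeData`, `PC`, `mset`, `msetDrop`, `thicken`, `Admissible`, `thicken_mono`,
`Admissible.mono`, `pc_of_sum_lt`, `depth_le_of_pair`, `layer_thickness_eq`, `mset_sum`, `mem_mset`,
`mem_msetDrop`, `mset_nonneg`, `msetDrop_nonneg`, `msetDrop_sum_eq`, `msetDrop_sum_le`, `Usum_mset`,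
`Usum_msetDrop_le`, `Usum_antitone`, `le_bigU_of_le`, `sum_le_sum_add_of_close`, `bigU_perturb_le`,
`pc_clause_of_staircase`, `pc_of_thicken_simplex`, `Staircase`, `OmegaF`, `OmegaG`, `admissible`.
-/

open Finset
open Literature.NumberTheory.Sieve (scaledSimplex)

namespace Summit.Parity.GeneralizedHardyLittlewood.Theorems.Dhl42

/-! ### §1. Definitions 4.1 and 4.2 -/

/-- The part of the data of §4.1 (`ss:norm`, eqs. (4.1)–(4.2)) that enters the pair condition:
for each grade `g`, the quantities `L_g`, `c_g` and the multiplicity `i_g`. -/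
structure GradeData (n : ℕ) where
  /-- `L_g` -/
  L : Fin n → ℝ
  /-- `c_g = 2δ_g/θ` -/
  c : Fin n → ℝ
  /-- `i_g` (grade `g` uses `MPZ^{(i_g)}[ϖ_g, δ_g]`) -/
  i : Fin n → ℕ

/-- **Definition 4.1** (`def:PC`), the graded pair condition `PC_ϱ(T, T')` for finite multisets
`T, T'` of reals: for every grade `g`, if `Σ T + Σ T' ≥ L_g − ϱ` then
`U_T(v) + U_{T'}(v) ≤ L_g + c_g − i_g v − ϱ` for every element `v` of `T ⊎ T'` with `v > c_g`
(`U_V = Usum`, `Dhl42ChainCondC`). -/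
def PC {n : ℕ} (D : GradeData n) (ϱ : ℝ) (T T' : Multiset ℝ) : Prop :=
  ∀ g : Fin n, D.L g - ϱ ≤ T.sum + T'.sum →
    ∀ v ∈ T + T', D.c g < v → Usum T v + Usum T' v ≤ D.L g + D.c g - (D.i g : ℝ) * v - ϱ

/-- The coordinate multiset `{t_1, …, t_k}` of a point. -/
def mset {k : ℕ} (t : Fin k → ℝ) : Multiset ℝ := Finset.univ.val.map t

/-- The coordinate multiset of `t^{(m)}` (the point `t` with its `m`-th coordinate removed). -/
def msetDrop {k : ℕ} (t : Fin k → ℝ) (m : Fin k) : Multiset ℝ := (Finset.univ.erase m).val.map t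

/-- `Ω^{+ϱ}` (**Definition 4.2**, `def:adm`): the points `s ∈ [0,∞)^k` with `‖s − t‖_∞ ≤ ϱ` for some
`t ∈ Ω`. -/
def thicken {k : ℕ} (Ω : Set (Fin k → ℝ)) (ϱ : ℝ) : Set (Fin k → ℝ) :=
  {s | (∀ j, 0 ≤ s j) ∧ ∃ t ∈ Ω, ∀ j, |s j - t j| ≤ ϱ}

/-- **Definition 4.2** (`def:adm`): the pair `(Ω, Ω')`, `Ω ⊆ [0,∞)^k`, `Ω' ⊆ [0,∞)^{k'}`
(`k' = k − 1` in the paper), is `ϱ`-admissible for the grade data `D` if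
(i) `PC_ϱ(s^{(m)}, s')` for all `s ∈ Ω^{+ϱ}`, `s' ∈ Ω'^{+ϱ}`, `1 ≤ m ≤ k`, and
(ii) `PC_ϱ(s', s'')` for all `s', s'' ∈ Ω'^{+ϱ}`. -/
def Admissible {n k k' : ℕ} (D : GradeData n) (ϱ : ℝ) (Ω : Set (Fin k → ℝ))
    (Ω' : Set (Fin k' → ℝ)) : Prop :=
  (∀ s ∈ thicken Ω ϱ, ∀ s' ∈ thicken Ω' ϱ, ∀ m : Fin k, PC D ϱ (msetDrop s m) (mset s')) ∧
  (∀ s' ∈ thicken Ω' ϱ, ∀ s'' ∈ thicken Ω' ϱ, PC D ϱ (mset s') (mset s''))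

/-- Thickening is monotone: `Ω₁ ⊆ Ω₂` implies `Ω₁^{+ϱ} ⊆ Ω₂^{+ϱ}`. -/
theorem thicken_mono {k : ℕ} {Ω₁ Ω₂ : Set (Fin k → ℝ)} (h : Ω₁ ⊆ Ω₂) (ϱ : ℝ) :
    thicken Ω₁ ϱ ⊆ thicken Ω₂ ϱ :=
  fun _ ⟨hs, t, ht, hst⟩ => ⟨hs, t, h ht, hst⟩

/-- Shrinking either region preserves admissibility (used in Remark 5.4, `rem:banded`, last sentence,
and for the reduction "banded regions ⊆ graded regions" of §7.1). -/
theorem Admissible.mono {n k k' : ℕ} {D : GradeData n} {ϱ : ℝ} {Ω₁ Ω₂ : Set (Fin k → ℝ)}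
    {Ω₁' Ω₂' : Set (Fin k' → ℝ)} (h : Admissible D ϱ Ω₂ Ω₂') (hΩ : Ω₁ ⊆ Ω₂) (hΩ' : Ω₁' ⊆ Ω₂') :
    Admissible D ϱ Ω₁ Ω₁' :=
  ⟨fun s hs s' hs' m => h.1 s (thicken_mono hΩ ϱ hs) s' (thicken_mono hΩ' ϱ hs') m,
    fun s' hs' s'' hs'' => h.2 s' (thicken_mono hΩ' ϱ hs') s'' (thicken_mono hΩ' ϱ hs'')⟩

/-- A pair condition whose every grade clause is vacuous. -/
theorem pc_of_sum_lt {n : ℕ} (D : GradeData n) {ϱ : ℝ} {T T' : Multiset ℝ}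
    (h : ∀ g, T.sum + T'.sum < D.L g - ϱ) : PC D ϱ T T' := by
  intro g hg
  exact absurd hg (not_le.2 (h g))

/-! ### §2. Proposition 5.1: the pair condition is a top-layer condition -/

/-- **Proposition 5.1** (`prop:PC`), first sentence: if `Σ T ≤ S`, `Σ T' ≤ K` and
`Σ T + Σ T' ≥ L_g − ϱ`, then both depths `S − Σ T` and `K − Σ T'` are at most `S + K − L_g + ϱ`. -/
theorem depth_le_of_pair {sT sT' S K L ϱ : ℝ} (hT : sT ≤ S) (hT' : sT' ≤ K) (h : L - ϱ ≤ sT + sT') :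
    S - sT ≤ S + K - L + ϱ ∧ K - sT' ≤ S + K - L + ϱ := by
  constructor <;> linarith

/-- **Proposition 5.1**, second sentence (the identities for the layer thicknesses): with
`θ = 1/2 + 2ϖ_n`, `S = 1 + ε`, `K = 1 − ε`, `L_1 = 1/θ − ε₁`, `L_g = (1 + 4ϖ_{g−1})/θ` (`g ≥ 2`):
`S + K = 2 = (1 + 4ϖ_n)/θ`, hence `S + K − L_g = 4(ϖ_n − ϖ_{g−1})/θ` and
`S + K − L_1 = 4ϖ_n/θ + ε₁ = 8ϖ_n/(1 + 4ϖ_n) + ε₁`. -/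
theorem layer_thickness_eq {θ ϖn ϖ' ε ε₁ : ℝ} (hθ : θ = 1 / 2 + 2 * ϖn) (hθ0 : θ ≠ 0) :
    (1 + ε) + (1 - ε) = (1 + 4 * ϖn) / θ ∧
    (1 + 4 * ϖn) / θ - (1 + 4 * ϖ') / θ = 4 * (ϖn - ϖ') / θ ∧
    (1 + 4 * ϖn) / θ - (1 / θ - ε₁) = 4 * ϖn / θ + ε₁ ∧
    4 * ϖn / θ = 8 * ϖn / (1 + 4 * ϖn) := by
  have h1 : (1 : ℝ) + 4 * ϖn ≠ 0 := by
    intro h; apply hθ0; rw [hθ]; linarith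
  refine ⟨?_, by ring, by ring, ?_⟩
  · rw [eq_div_iff hθ0, hθ]; ring
  · rw [div_eq_div_iff hθ0 h1, hθ]; ring

/-! ### §3. Coordinate multisets, perturbations, and `U` -/

/-- The coordinate multiset has sum `Σ_j t_j`. -/
theorem mset_sum {k : ℕ} (t : Fin k → ℝ) : (mset t).sum = ∑ j, t j := by
  simp [mset, Finset.sum_eq_multiset_sum]

/-- Every element of the coordinate multiset `mset t` is a coordinate of `t`. -/
theorem mem_mset {k : ℕ} {t : Fin k → ℝ} {v : ℝ} (h : v ∈ mset t) : ∃ j, t j = v := by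
  simpa [mset] using h

/-- Every element of `msetDrop t m` is a coordinate of `t`. -/
theorem mem_msetDrop {k : ℕ} {t : Fin k → ℝ} {m : Fin k} {v : ℝ} (h : v ∈ msetDrop t m) :
    ∃ j, t j = v := by
  simp only [msetDrop, Multiset.mem_map, Finset.mem_val, Finset.mem_erase] at h
  obtain ⟨j, _, hj⟩ := h
  exact ⟨j, hj⟩

/-- The coordinate multiset of a point of `[0,∞)^k` consists of non-negative reals. -/
theorem mset_nonneg {k : ℕ} {t : Fin k → ℝ} (ht : ∀ j, 0 ≤ t j) : ∀ x ∈ mset t, 0 ≤ x := by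
  intro x hx; obtain ⟨j, rfl⟩ := mem_mset hx; exact ht j

/-- `msetDrop t m` consists of non-negative reals when `t ∈ [0,∞)^k`. -/
theorem msetDrop_nonneg {k : ℕ} {t : Fin k → ℝ} (ht : ∀ j, 0 ≤ t j) (m : Fin k) :
    ∀ x ∈ msetDrop t m, 0 ≤ x := by
  intro x hx; obtain ⟨j, rfl⟩ := mem_msetDrop hx; exact ht j

/-- `Σ (msetDrop t m) = Σ_{j ≠ m} t_j`. -/
theorem msetDrop_sum_eq {k : ℕ} (t : Fin k → ℝ) (m : Fin k) :
    (msetDrop t m).sum = ∑ j ∈ Finset.univ.erase m, t j := by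
  simp [msetDrop, Finset.sum_eq_multiset_sum]

/-- `Σ (msetDrop t m) ≤ Σ_j t_j` for `t ∈ [0,∞)^k` (the dropped coordinate is non-negative). -/
theorem msetDrop_sum_le {k : ℕ} {t : Fin k → ℝ} (ht : ∀ j, 0 ≤ t j) (m : Fin k) :
    (msetDrop t m).sum ≤ ∑ j, t j := by
  rw [msetDrop_sum_eq]
  exact Finset.sum_le_sum_of_subset_of_nonneg (Finset.erase_subset _ _) fun j _ _ => ht j

/-- `U_{mset t}(u) = U_t(u)`: the multiset `U` of the coordinate multiset is the Part-5 `bigU`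
(`bigU_eq_Usum` read backwards). -/
theorem Usum_mset {k : ℕ} (t : Fin k → ℝ) (u : ℝ) : Usum (mset t) u = bigU t u :=
  (bigU_eq_Usum t u).symm

/-- `U_{t^{(m)}}(u) ≤ U_t(u)` (dropping a non-negative coordinate). -/
theorem Usum_msetDrop_le {k : ℕ} {t : Fin k → ℝ} (ht : ∀ j, 0 ≤ t j) (m : Fin k) (u : ℝ) :
    Usum (msetDrop t m) u ≤ bigU t u := by
  classical
  unfold Usum msetDrop bigU
  rw [Multiset.filter_map, ← Finset.filter_val, ← Finset.sum_eq_multiset_sum, Finset.sum_filter]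
  exact Finset.sum_le_sum_of_subset_of_nonneg (Finset.erase_subset _ _) fun j _ _ => by
    split_ifs <;> [exact ht j; exact le_rfl]

/-- `U_V` is non-increasing in the level, for multisets of non-negative reals. -/
theorem Usum_antitone {V : Multiset ℝ} (hV : ∀ x ∈ V, 0 ≤ x) {u u' : ℝ} (h : u ≤ u') :
    Usum V u' ≤ Usum V u := by
  unfold Usum
  have hle : V.filter (fun x => u' ≤ x) ≤ V.filter (fun x => u ≤ x) :=
    Multiset.monotone_filter_right V fun x hx => le_trans h hx
  obtain ⟨R, hR⟩ := Multiset.le_iff_exists_add.1 hle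
  rw [hR, Multiset.sum_add]
  have : 0 ≤ R.sum := Multiset.sum_nonneg fun x hx => by
    have hx' : x ∈ V.filter (fun x => u ≤ x) := by rw [hR]; exact Multiset.mem_add.2 (Or.inr hx)
    exact hV x (Multiset.mem_of_mem_filter hx')
  linarith

/-- A coordinate at least `u` is at most `U_t(u)` (non-negative coordinates). -/
theorem le_bigU_of_le {k : ℕ} {t : Fin k → ℝ} (ht : ∀ j, 0 ≤ t j) {u : ℝ} {l : Fin k}
    (h : u ≤ t l) : t l ≤ bigU t u := by
  classical
  unfold bigU
  have := Finset.single_le_sum (f := fun j => if u ≤ t j then t j else 0)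
    (fun j _ => by split_ifs <;> [exact ht j; exact le_rfl]) (Finset.mem_univ l)
  simpa [if_pos h] using this

/-- Sums under an `ℓ^∞`-perturbation of size `ϱ`. -/
theorem sum_le_sum_add_of_close {k : ℕ} {s t : Fin k → ℝ} {ϱ : ℝ} (h : ∀ j, |s j - t j| ≤ ϱ) :
    ∑ j, s j ≤ ∑ j, t j + k * ϱ := by
  have : ∑ j, s j ≤ ∑ j, (t j + ϱ) :=
    Finset.sum_le_sum fun j _ => by have := (abs_le.1 (h j)).2; linarith
  simpa [Finset.sum_add_distrib, Finset.sum_const, Finset.card_univ, Fintype.card_fin,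
    nsmul_eq_mul] using this

/-- The perturbation step of the proof of Proposition 5.3: if `‖s − t‖_∞ ≤ ϱ` (`ϱ ≥ 0`, `t ≥ 0`)
then `U_s(u + ϱ) ≤ Σ_{l : t_l ≥ u} (t_l + ϱ) ≤ U_t(u) + k ϱ`. -/
theorem bigU_perturb_le {k : ℕ} {s t : Fin k → ℝ} {ϱ : ℝ} (ht : ∀ j, 0 ≤ t j)
    (h : ∀ j, |s j - t j| ≤ ϱ) (hϱ : 0 ≤ ϱ) (u : ℝ) :
    bigU s (u + ϱ) ≤ bigU t u + k * ϱ := by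
  classical
  unfold bigU
  have : (∑ j, if u + ϱ ≤ s j then s j else 0) ≤ ∑ j, ((if u ≤ t j then t j else 0) + ϱ) := by
    refine Finset.sum_le_sum fun j _ => ?_
    have h1 := (abs_le.1 (h j)).1
    have h2 := (abs_le.1 (h j)).2
    by_cases hj : u + ϱ ≤ s j
    · rw [if_pos hj, if_pos (by linarith)]; linarith
    · rw [if_neg hj]
      have : 0 ≤ (if u ≤ t j then t j else 0) := by split_ifs <;> [exact ht j; exact le_rfl]
      linarith
  simpa [Finset.sum_add_distrib, Finset.sum_const, Finset.card_univ, Fintype.card_fin,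
    nsmul_eq_mul] using this

/-! ### §4. Proposition 5.3, one grade: the heart of the argument -/

/-- **Proposition 5.3** (`prop:stairadm`), part (i) of Definition 4.2 for ONE grade, for general
data.  Setting: dimensions `k` (for `Ω`) and `k'` (for `Ω'`; `k' = k − 1` in the paper); simplex sizes
`S ≥ K`; `ϱ > 0`; the grade's `L, c`, multiplicity `ι ≥ 0`, layer thickness `ε₂`, its `M = J + 1`
levels `u_0, …, u_J` extended by the sentinel `u_{J+1} = S + ϱ` (the vector `uE : Fin (M+1) → ℝ`),
and thresholds `τ^F_j, τ^G_j`.  Hypotheses (i)–(iii) are the paper's, with the constant `2k + 1`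
replaced by any `A ≥ k + k' + 2` (equal to it when `k' = k − 1`).  If `t ∈ S·R_k` and `t' ∈ K·R_{k'}`
satisfy the grade's staircase alternative of Definition 5.2, `s, s' ≥ 0` are `ϱ`-close to `t, t'`, and
`Σ s^{(m)} + Σ s' ≥ L − ϱ`, then `U_{s^{(m)}}(v) + U_{s'}(v) ≤ L + c − ι v − ϱ` for every element
`v > c` of `s^{(m)} ⊎ s'`.  (Neither monotonicity of the levels nor signs of the thresholds are needed.) -/
theorem pc_clause_of_staircase {k k' M : ℕ} {S K ϱ L c ε₂ ι A : ℝ}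
    {uE : Fin (M + 1) → ℝ} {τF τG : Fin M → ℝ}
    (hϱ : 0 < ϱ) (hKS : K ≤ S) (hι : 0 ≤ ι) (hA : (k : ℝ) + k' + 2 ≤ A)
    (h_i : S + K - L + A * ϱ ≤ ε₂)
    (h_ii : ∀ j : Fin M, τF j + τG j ≤ L + c - ι * uE j.succ - (A + ι) * ϱ ∨
      (τF j < uE j.castSucc ∧ τG j < uE j.castSucc))
    (h_iii : uE 0 ≤ c - ϱ) (h_last : uE (Fin.last M) = S + ϱ)
    {t s : Fin k → ℝ} {t' s' : Fin k' → ℝ}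
    (ht : t ∈ scaledSimplex k S)
    (ht_st : (∑ j, t j) ≤ S - ε₂ ∨ ∀ j : Fin M, bigU t (uE j.castSucc) ≤ τF j)
    (ht' : t' ∈ scaledSimplex k' K)
    (ht'_st : (∑ j, t' j) ≤ K - ε₂ ∨ ∀ j : Fin M, bigU t' (uE j.castSucc) ≤ τG j)
    (hs : ∀ j, 0 ≤ s j) (hst : ∀ j, |s j - t j| ≤ ϱ)
    (hs' : ∀ j, 0 ≤ s' j) (hst' : ∀ j, |s' j - t' j| ≤ ϱ) (m : Fin k)
    (hsum : L - ϱ ≤ (msetDrop s m).sum + (mset s').sum) :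
    ∀ v ∈ msetDrop s m + mset s', c < v →
      Usum (msetDrop s m) v + Usum (mset s') v ≤ L + c - ι * v - ϱ := by
  classical
  -- expanded form of `A ≥ k + k' + 2`
  have hAϱ : (k : ℝ) * ϱ + k' * ϱ + 2 * ϱ ≤ A * ϱ := by
    have := mul_le_mul_of_nonneg_right hA hϱ.le
    linarith [add_mul ((k : ℝ) + k') 2 ϱ, add_mul (k : ℝ) k' ϱ]
  -- Step 1: the sums of `t, t'` are large
  have hSs : (msetDrop s m).sum ≤ (∑ j, t j) + k * ϱ :=
    le_trans (msetDrop_sum_le hs m) (sum_le_sum_add_of_close hst)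
  have hSs' : (mset s').sum ≤ (∑ j, t' j) + k' * ϱ := by
    rw [mset_sum]; exact sum_le_sum_add_of_close hst'
  have htt' : L - ϱ - k * ϱ - k' * ϱ ≤ (∑ j, t j) + ∑ j, t' j := by linarith
  -- Step 2: both points lie in the top layers, so the staircase constraints are active
  have hUt : ∀ j : Fin M, bigU t (uE j.castSucc) ≤ τF j := by
    rcases ht_st with h | h
    · exfalso; have := ht'.2; linarith
    · exact h
  have hUt' : ∀ j : Fin M, bigU t' (uE j.castSucc) ≤ τG j := by
    rcases ht'_st with h | h
    · exfalso; have := ht.2; linarith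
    · exact h
  -- Step 3: locate `v` between two consecutive extended levels
  intro v hv hcv
  have hv_le : v ≤ S + ϱ := by
    rcases Multiset.mem_add.1 hv with h | h
    · obtain ⟨l, rfl⟩ := mem_msetDrop h
      have h1 : t l ≤ ∑ j, t j := Finset.single_le_sum (fun j _ => ht.1 j) (Finset.mem_univ l)
      have h2 := (abs_le.1 (hst l)).2
      linarith [ht.2]
    · obtain ⟨l, rfl⟩ := mem_mset h
      have h1 : t' l ≤ ∑ j, t' j := Finset.single_le_sum (fun j _ => ht'.1 j) (Finset.mem_univ l)
      have h2 := (abs_le.1 (hst' l)).2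
      linarith [ht'.2]
  obtain ⟨P, hP⟩ : ∃ P : Finset (Fin (M + 1)), ∀ x, x ∈ P ↔ uE x + ϱ ≤ v :=
    ⟨Finset.univ.filter fun j => uE j + ϱ ≤ v, fun x => by simp⟩
  have hP0 : (0 : Fin (M + 1)) ∈ P := (hP 0).2 (by linarith)
  have hPne : P.Nonempty := ⟨0, hP0⟩
  have hjm_mem : uE (P.max' hPne) + ϱ ≤ v := (hP _).1 (P.max'_mem hPne)
  have hjm_max : ∀ x : Fin (M + 1), uE x + ϱ ≤ v → x ≤ P.max' hPne := fun x hx =>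
    P.le_max' x ((hP x).2 hx)
  have hjm_ne : P.max' hPne ≠ Fin.last M := by
    intro h; rw [h, h_last] at hjm_mem; linarith
  obtain ⟨j, hj⟩ := Fin.exists_castSucc_eq.2 hjm_ne
  have hjv : uE j.castSucc + ϱ ≤ v := by rw [hj]; exact hjm_mem
  have hvj : v < uE j.succ + ϱ := by
    by_contra h
    have h1 := hjm_max j.succ (not_lt.1 h)
    rw [← hj] at h1
    exact absurd h1 (not_le.2 (Fin.castSucc_lt_succ (i := j)))
  -- Step 4: the second alternative of (ii) at `j` is impossible
  have h_first : τF j + τG j ≤ L + c - ι * uE j.succ - (A + ι) * ϱ := by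
    rcases h_ii j with h1 | ⟨hF, hG⟩
    · exact h1
    exfalso
    rcases Multiset.mem_add.1 hv with h | h
    · obtain ⟨l, hl⟩ := mem_msetDrop h
      have htl : t l < uE j.castSucc := by
        by_contra hc
        have := le_bigU_of_le ht.1 (not_lt.1 hc)
        linarith [hUt j]
      have h2 := (abs_le.1 (hst l)).2
      linarith
    · obtain ⟨l, hl⟩ := mem_mset h
      have htl : t' l < uE j.castSucc := by
        by_contra hc
        have := le_bigU_of_le ht'.1 (not_lt.1 hc)
        linarith [hUt' j]
      have h2 := (abs_le.1 (hst' l)).2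
      linarith
  -- Step 5: bound the two `U`'s through the unperturbed points
  have hU1 : Usum (msetDrop s m) v ≤ τF j + k * ϱ :=
    calc Usum (msetDrop s m) v ≤ Usum (msetDrop s m) (uE j.castSucc + ϱ) :=
          Usum_antitone (msetDrop_nonneg hs m) hjv
      _ ≤ bigU s (uE j.castSucc + ϱ) := Usum_msetDrop_le hs m _
      _ ≤ bigU t (uE j.castSucc) + k * ϱ := bigU_perturb_le ht.1 hst hϱ.le _
      _ ≤ τF j + k * ϱ := by linarith [hUt j]
  have hU2 : Usum (mset s') v ≤ τG j + k' * ϱ :=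
    calc Usum (mset s') v ≤ Usum (mset s') (uE j.castSucc + ϱ) :=
          Usum_antitone (mset_nonneg hs') hjv
      _ = bigU s' (uE j.castSucc + ϱ) := Usum_mset s' _
      _ ≤ bigU t' (uE j.castSucc) + k' * ϱ := bigU_perturb_le ht'.1 hst' hϱ.le _
      _ ≤ τG j + k' * ϱ := by linarith [hUt' j]
  have hιv : ι * v ≤ ι * uE j.succ + ι * ϱ := by
    rw [← mul_add]; exact mul_le_mul_of_nonneg_left hvj.le hι
  linarith [add_mul A ι ϱ]

/-- Part (ii) of Definition 4.2 in Proposition 5.3 is vacuous: two points of `(K·R_{k'})^{+ϱ}` have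
total coordinate sum `≤ 2K + 2k'ϱ < L_g − ϱ`. -/
theorem pc_of_thicken_simplex {n k' : ℕ} (D : GradeData n) {K ϱ B : ℝ} {Ω' : Set (Fin k' → ℝ)}
    (hΩ' : Ω' ⊆ scaledSimplex k' K) (hB : 2 * (k' : ℝ) ≤ B) (hϱ : 0 ≤ ϱ)
    (h_iv : ∀ g, 2 * K + B * ϱ < D.L g - ϱ) {s' s'' : Fin k' → ℝ}
    (hs' : s' ∈ thicken Ω' ϱ) (hs'' : s'' ∈ thicken Ω' ϱ) : PC D ϱ (mset s') (mset s'') := by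
  obtain ⟨-, t', ht', hst'⟩ := hs'
  obtain ⟨-, t'', ht'', hst''⟩ := hs''
  refine pc_of_sum_lt D fun g => ?_
  rw [mset_sum, mset_sum]
  have h1 := sum_le_sum_add_of_close hst'
  have h2 := sum_le_sum_add_of_close hst''
  have hBϱ : 2 * (k' : ℝ) * ϱ ≤ B * ϱ := mul_le_mul_of_nonneg_right hB hϱ
  linarith [(hΩ' ht').2, (hΩ' ht'').2, h_iv g]

/-! ### §5. Definition 5.2 and Proposition 5.3 for general graded staircase data -/

/-- **Definition 5.2** (`def:stair`), the data: for each grade `g`, a layer thickness `ε_{2,g}`,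
`M_g = J_g + 1 ≥ 0` levels `u^g_0, …, u^g_{J_g}` given as a vector `uE g : Fin (M_g + 1) → ℝ` whose
LAST entry is the sentinel `u^g_{J_g+1}` of Proposition 5.3 (the levels are `uE g j.castSucc`), and
thresholds `τ^{F,g}_j, τ^{G,g}_j`. -/
structure Staircase (n : ℕ) where
  /-- number of levels of grade `g` (`J_g + 1`) -/
  M : Fin n → ℕ
  /-- the levels of grade `g`, extended by the sentinel `u^g_{J_g+1}` as last entry -/
  uE : (g : Fin n) → Fin (M g + 1) → ℝ
  /-- `τ^{F,g}_j` -/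
  τF : (g : Fin n) → Fin (M g) → ℝ
  /-- `τ^{G,g}_j` -/
  τG : (g : Fin n) → Fin (M g) → ℝ
  /-- `ε_{2,g}` -/
  eps2 : Fin n → ℝ

namespace Staircase

/-- **Definition 5.2**: `Ω = {t ∈ S·R_k : ∀ g, Σ t ≤ S − ε_{2,g} or U_t(u^g_j) ≤ τ^{F,g}_j ∀ j}`. -/
def OmegaF {n : ℕ} (Z : Staircase n) (k : ℕ) (S : ℝ) : Set (Fin k → ℝ) :=
  {t ∈ scaledSimplex k S |
    ∀ g, (∑ j, t j) ≤ S - Z.eps2 g ∨ ∀ j : Fin (Z.M g), bigU t (Z.uE g j.castSucc) ≤ Z.τF g j}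

/-- **Definition 5.2**: `Ω' = {t' ∈ K·R_{k'} : ∀ g, Σ t' ≤ K − ε_{2,g} or U_{t'}(u^g_j) ≤ τ^{G,g}_j ∀ j}`. -/
def OmegaG {n : ℕ} (Z : Staircase n) (k' : ℕ) (K : ℝ) : Set (Fin k' → ℝ) :=
  {t ∈ scaledSimplex k' K |
    ∀ g, (∑ j, t j) ≤ K - Z.eps2 g ∨ ∀ j : Fin (Z.M g), bigU t (Z.uE g j.castSucc) ≤ Z.τG g j}

/-- **Proposition 5.3** (`prop:stairadm`) for general data: under (i) `ε_{2,g} ≥ S + K − L_g + Aϱ₀`,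
(ii) for each level `j` of grade `g`: `τ^{F,g}_j + τ^{G,g}_j ≤ L_g + c_g − i_g u^g_{j+1} − (A + i_g)ϱ₀`
or (`τ^{F,g}_j < u^g_j` and `τ^{G,g}_j < u^g_j`), (iii) `u^g_0 ≤ c_g − ϱ₀`, the sentinel convention
`u^g_{J_g+1} = S + ϱ₀`, and (iv) `2K + Bϱ₀ < L_g − ϱ₀` for every `g`, the pair `(Ω, Ω')` of
Definition 5.2 is `ϱ₀`-admissible.  Here `A ≥ k + k' + 2` and `B ≥ 2k'` are free; for `k' = k − 1`,
`A = 2k + 1`, `B = 2k − 1` these are the printed hypotheses, except that the paper states (iv) for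
`g = 1` only and has `L_1 < L_2 < ⋯ < L_n` from (4.2).  `K ≤ S`, `ϱ₀ > 0`. -/
theorem admissible {n k k' : ℕ} (Z : Staircase n) (D : GradeData n) {S K ϱ A B : ℝ}
    (hϱ : 0 < ϱ) (hKS : K ≤ S) (hA : (k : ℝ) + k' + 2 ≤ A) (hB : 2 * (k' : ℝ) ≤ B)
    (h_i : ∀ g, S + K - D.L g + A * ϱ ≤ Z.eps2 g)
    (h_ii : ∀ g, ∀ j : Fin (Z.M g),
      Z.τF g j + Z.τG g j ≤ D.L g + D.c g - (D.i g : ℝ) * Z.uE g j.succ - (A + D.i g) * ϱ ∨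
        (Z.τF g j < Z.uE g j.castSucc ∧ Z.τG g j < Z.uE g j.castSucc))
    (h_iii : ∀ g, Z.uE g 0 ≤ D.c g - ϱ) (h_last : ∀ g, Z.uE g (Fin.last _) = S + ϱ)
    (h_iv : ∀ g, 2 * K + B * ϱ < D.L g - ϱ) :
    Admissible D ϱ (Z.OmegaF k S) (Z.OmegaG k' K) := by
  refine ⟨fun s hs s' hs' m g hsum => ?_, fun s' hs' s'' hs'' =>
    pc_of_thicken_simplex D (fun t ht => ht.1) hB hϱ.le h_iv hs' hs''⟩
  obtain ⟨hs0, t, ht, hst⟩ := hs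
  obtain ⟨hs0', t', ht', hst'⟩ := hs'
  exact pc_clause_of_staircase hϱ hKS (Nat.cast_nonneg _) hA (h_i g) (h_ii g) (h_iii g) (h_last g)
    ht.1 (ht.2 g) ht'.1 (ht'.2 g) hs0 hst hs0' hst' m hsum

end Staircase
end Summit.Parity.GeneralizedHardyLittlewood.Theorems.Dhl42
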